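import Summits.AtomisticToContinuum.Crystallization.Theorems.ChargedEnergyGapKinkBudget
import HarnessLib
/-!
# Charged energy gap — KINK CERTIFICATES, file B: the reflected branch-and-bound checker and its SOUNDNESS

student team «lens-3» (decomposition, residual mode), generation 84, NODE 85 «KinkCert».  Line of record `stmt-AtomisticToContinuum-14231`
(`Summit.AtomisticToContinuum.ChargedEnergyGap`), route PricedLinkCensus; namespace `…Theorems.ChargedEnergyGapChartDial`.

NODE 84 (`…ChargedEnergyGapKinkBudget{A,B,C,D,}`, cone `chargedEnergyGap_of_kinkBudget_numerics`, 33 hypotheses) left ONE open leaf on the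
one-dimensional branch, the finite three-hole system (Σ₃) `ThreeHoleSystemQ (679/1000) (691/1000)`: a closed statement of real arithmetic (scale
`ρ`, two even gap lengths `n₁, n₂`, per hole depth `e`, missing-row depth `m`, kink parts `a, b`, kink `k`; two legs, four parabolas, the window
`ρ(n₁+n₂) ≤ 160 + 2ρ` ⟹ `ThreeHoleGoal`, i.e. the two non-key table charges are within the line excess of the key column).  The census
instrument FLO-84 (exact-ℚ branch and bound, 96 trees / 77,658 nodes, 2026-09-03) decided (Σ₃) TRUE; this file makes that decision a THEOREM
SCHEMA: a reflected checker `kcCheck` over certificates `KcT`, evaluated by the kernel (`decide +kernel`, files C1–C9), and ★★ its soundness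
`kcCheck_sound` / `kc_case_sound`, proved here once and for all.

## The checker (§K)
All quantities are NATURALS scaled by `kcD = 10⁴·2⁴⁴` (kinks carried as `t = 10k`, charges and budgets ×10), so every kernel test is a comparison of
sums of products of naturals (GMP).  A state `KcS` is a TIGHTENED box: `ρ·D ∈ [rlo, rhi]` and per hole `a·D ∈ [alo, ahi]`, `b·D ∈ [blo, bhi]`,
`max(a,b)·D ≥ mx`, `e·D ∈ [elo, ehi]` (`kcTight`: `b = kρ − a`, `e ≥ 93.5 + max(a,b)`, `e ≤ 140 + ρ`, floors for lower and ceilings for upper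
bounds).  A certificate node is `.S ax lo hi` (split the box at the midpoint of axis `ax ∈ {e₁,e₂,e₃,a₁,a₂,a₃,ρ}` and re-tighten) or a LEAF:
`.C rA rB rA' rB'` (charge budget: the two non-key missing rows lie in rows `rA..rB`, `rA'..rB'` — checked against the scaled row cells — and the
range maxima of `10·capKRows` fit the budget `E10`; `rA = 0` flags an infeasible hole), `.L` (joint leg budget: `A₁ + A₂ + B₂ + B₃ ≤ 2ρ²(n₁+n₂−2)
≤ 2ρhi²(nmax−2)` contradicts the lower bounds of the four turn costs, the coupled pair `A₂ + B₂` minimised over THREE candidates `a₂ ∈ {alo, ahi,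
k₂ρlo − blo}` — the cost is concave on two pieces), `.W n₁ nL₁ cov₁ nL₂ cov₂` (window: gap 1 needs `≥ n₁` steps and gap 2 does not fit into
`nmax − n₁`, each even step count being excluded by a relaxed LEG test (prefix `≤ nL`) or a relaxed PARABOLA test on pieces `[u,v]`, checked at
both ends only — the relaxed tests are convex in the step count and in the source depth).

## Soundness (§S)
`KcConf.Adm` = the hypotheses of (Σ₃) for kinks EXACTLY `tᵢ/10` (§S3); `kcTight_mem`, `kcRoot_mem`, `kcSplit_mem` (§S4: tightening, root and
splits keep every admissible configuration in the box); `kcLeafL_false` (§S5, the three-candidate concavity lemma `kc_psi_three`), `kcLeafW_false`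
(§S6, convexity lemmas `kc_parF_between`, `kc_par_contra`, `kc_leg_contra`, piece induction `kcPieces_false`), `kcLeafC_sound` (§S7, row cells
`kc_row_cell`, table `kc_tab10` by one kernel decision); ★★ `kcCheck_sound` by structural induction on the certificate and the driver
`kc_case_sound` (§S8).  §S9 reduces real hole data `IsHoleData ρ e m a b k` with `capKCol k = c` to the checker's hypotheses by shrinking the kink
to the column floor `(c+8)/10` (`kc_hyp_of_holeData`: every hypothesis of (Σ₃) is antitone in the turn costs, the goal reads the column only) and
states the two CASE LEMMAS `kc_outer_of_cert` (key = hole 1, columns `(j, c₂, c₃)`) and `kc_mid_of_cert` (key = hole 2 in column 3), which turn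
a root certificate into the corresponding clause of `ThreeHoleGoal` on the designated band `ρ·D ∈ [kcRLO, kcRHI] = [0.679·D, 0.691·D]`; §S10 the
four line excesses `E(j,3)`.  Assembly of the 54 + 4 cases: `ChargedEnergyGapKinkCert.lean`.

Imports ONLY `…ChargedEnergyGapKinkBudget` and `HarnessLib`; no `set_option`, no `sorry`, no instance, no notation, no `private`, no
`native_decide` (`decide +kernel` only for the table transcription `kcTabOK_true` and the four line-excess cells `kc_lineRow1_j`); no new
constants enter the statement of (Σ₃).

SPLIT (400-line cap): this module = file B part 1/4 (§K the checker, §S1 arithmetic helpers, §S2 window count / row cells / table); part 2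
`…KinkCertB2` (§S3 semantics, §S4 tightening/root/split membership, §S5 L leaf), part 3 `…KinkCertB3` (§S6 W leaf, §S7 C leaf, §S8 soundness),
part 4 `…KinkCertB4` (§S9 hole data → checker hypotheses and the two case lemmas, §S10 line excesses).  The certificate files `…KinkCertC1…`
import part 1 only; the assembly `…KinkCert` imports part 4 and the last certificate file.
-/

namespace Summit.AtomisticToContinuum.Crystallization.Theorems.ChargedEnergyGapChartDial

/-! ## §K The reflected checker (scaled natural arithmetic) -/

/-- the scale `D`, and `93.5·D`, `140·D`. -/
def kcD : ℕ := 10000 * 2 ^ 44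
/-- `kcEMIN` (docstring added by the landing lane; see the module docstring). [formal bookkeeping] -/
def kcEMIN : ℕ := 935000 * 2 ^ 44
/-- `kcETOP` (docstring added by the landing lane; see the module docstring). [formal bookkeeping] -/
def kcETOP : ℕ := 1400000 * 2 ^ 44

/-- the designated band in the checker's scale: `0.679·D` and `0.691·D`. -/
def kcRLO : ℕ := 119450943241584640
/-- `kcRHI` (docstring added by the landing lane; see the module docstring). [formal bookkeeping] -/
def kcRHI : ℕ := 121562005566914560

/-- case data: columns `cᵢ`, kink floors `tᵢ = 10·colLo cᵢ`, key position `p ∈ {1, 2}`, budget `E10 = 10·E`. -/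
structure KcCase where
  c₁ : ℕ
  c₂ : ℕ
  c₃ : ℕ
  t₁ : ℕ
  t₂ : ℕ
  t₃ : ℕ
  p : ℕ
  E10 : ℕ

/-- one hole of the state: bounds for `a·D`, `b·D`, a lower bound `mx` for `max a b · D`, bounds for `e·D`. -/
structure KcH where
  alo : ℕ
  ahi : ℕ
  blo : ℕ
  bhi : ℕ
  mx : ℕ
  elo : ℕ
  ehi : ℕ

/-- checker state: bounds for `ρ·D` and three holes. -/
structure KcS where
  rlo : ℕ
  rhi : ℕ
  h₁ : KcH
  h₂ : KcH
  h₃ : KcH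

/-- certificate tree; split axes `0,1,2 = e₁,e₂,e₃`, `3,4,5 = a₁,a₂,a₃`, otherwise `ρ`. -/
inductive KcT where
  | C (rA rB rA' rB' : ℕ) : KcT
  | L : KcT
  | W (n₁ nL₁ : ℕ) (cov₁ : List (ℕ × ℕ × Bool)) (nL₂ : ℕ) (cov₂ : List (ℕ × ℕ × Bool)) : KcT
  | S (ax : ℕ) (tl th : KcT) : KcT

/-- re-tighten a hole for kink `t/10` and `ρ·D ∈ [rlo, rhi]` (floor for lower bounds, ceiling for the upper bound of `b`). -/
def kcTight (t rlo rhi : ℕ) (h : KcH) : KcH :=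
  let kr := t * rlo / 10
  let alo := max h.alo (kr - rlo)
  let ahi := min h.ahi rhi
  let blo := max (kr - ahi) (kr - rlo)
  let mx := max alo blo
  ⟨alo, ahi, blo, min rhi ((t * rhi + 9) / 10 - alo), mx, max h.elo (kcEMIN + mx), min h.ehi (kcETOP + rhi)⟩

/-- the root state for `ρ·D ∈ [rlo, rhi]`: everything else tightened from trivial bounds. -/
def kcRoot (cs : KcCase) (rlo rhi : ℕ) : KcS :=
  ⟨rlo, rhi, kcTight cs.t₁ rlo rhi ⟨0, rhi, 0, rhi, 0, 0, kcETOP + rhi⟩, kcTight cs.t₂ rlo rhi ⟨0, rhi, 0, rhi, 0, 0, kcETOP + rhi⟩,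
    kcTight cs.t₃ rlo rhi ⟨0, rhi, 0, rhi, 0, 0, kcETOP + rhi⟩⟩

/-- split the state on axis `ax` at the midpoint of the tightened interval. -/
def kcSplit (cs : KcCase) (s : KcS) (ax : ℕ) : KcS × KcS :=
  if ax = 0 then ({ s with h₁ := { s.h₁ with ehi := (s.h₁.elo + s.h₁.ehi) / 2 } }, { s with h₁ := { s.h₁ with elo := (s.h₁.elo + s.h₁.ehi) / 2 } })
  else if ax = 1 then ({ s with h₂ := { s.h₂ with ehi := (s.h₂.elo + s.h₂.ehi) / 2 } }, { s with h₂ := { s.h₂ with elo := (s.h₂.elo + s.h₂.ehi) / 2 } })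
  else if ax = 2 then ({ s with h₃ := { s.h₃ with ehi := (s.h₃.elo + s.h₃.ehi) / 2 } }, { s with h₃ := { s.h₃ with elo := (s.h₃.elo + s.h₃.ehi) / 2 } })
  else if ax = 3 then ({ s with h₁ := kcTight cs.t₁ s.rlo s.rhi { s.h₁ with ahi := (s.h₁.alo + s.h₁.ahi) / 2 } },
    { s with h₁ := kcTight cs.t₁ s.rlo s.rhi { s.h₁ with alo := (s.h₁.alo + s.h₁.ahi) / 2 } })
  else if ax = 4 then ({ s with h₂ := kcTight cs.t₂ s.rlo s.rhi { s.h₂ with ahi := (s.h₂.alo + s.h₂.ahi) / 2 } },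
    { s with h₂ := kcTight cs.t₂ s.rlo s.rhi { s.h₂ with alo := (s.h₂.alo + s.h₂.ahi) / 2 } })
  else if ax = 5 then ({ s with h₃ := kcTight cs.t₃ s.rlo s.rhi { s.h₃ with ahi := (s.h₃.alo + s.h₃.ahi) / 2 } },
    { s with h₃ := kcTight cs.t₃ s.rlo s.rhi { s.h₃ with alo := (s.h₃.alo + s.h₃.ahi) / 2 } })
  else (⟨s.rlo, (s.rlo + s.rhi) / 2, kcTight cs.t₁ s.rlo ((s.rlo + s.rhi) / 2) s.h₁, kcTight cs.t₂ s.rlo ((s.rlo + s.rhi) / 2) s.h₂,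
      kcTight cs.t₃ s.rlo ((s.rlo + s.rhi) / 2) s.h₃⟩,
    ⟨(s.rlo + s.rhi) / 2, s.rhi, kcTight cs.t₁ ((s.rlo + s.rhi) / 2) s.rhi s.h₁, kcTight cs.t₂ ((s.rlo + s.rhi) / 2) s.rhi s.h₂,
      kcTight cs.t₃ ((s.rlo + s.rhi) / 2) s.rhi s.h₃⟩)

/-- scaled cell edges of row `r`: rows `1..73` are `[93.5 + (r-1)/2, 93.5 + r/2)`, row `74` is `[130, 140)`. -/
def kcRLo (r : ℕ) : ℕ := if r ≤ 73 then (935000 + 5000 * (r - 1)) * 2 ^ 44 else 1300000 * 2 ^ 44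
/-- `kcRHi` (docstring added by the landing lane; see the module docstring). [formal bookkeeping] -/
def kcRHi (r : ℕ) : ℕ := if r ≤ 73 then (935000 + 5000 * r) * 2 ^ 44 else kcETOP

/-- `10 · capKRows` entry as a natural (`(q·10).num.toNat`; the table has denominators dividing 10). -/
def kcTab10 (r c : ℕ) : ℕ := (((capKRows.getD r []).getD c 0 : ℚ) * 10).num.toNat

/-- `max (0, 10·table over rows rA .. rA+len-1 of column c)` -/
def kcRangeMax (c rA : ℕ) : ℕ → ℕ
  | 0 => 0
  | len + 1 => max (kcTab10 (rA + len) c) (kcRangeMax c rA len)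

/-- every admissible missing-row depth `m·D ∈ [elo - rhi, ehi - mx]` of the hole lies in rows `rA..rB`. -/
def kcHoleRange (rhi : ℕ) (h : KcH) (rA rB : ℕ) : Bool :=
  decide (1 ≤ rA) && decide (rA ≤ rB) && decide (rB ≤ 74) &&
    (decide (rA = 1) || decide (kcRHi (rA - 1) ≤ h.elo - rhi)) && (decide (rB = 74) || decide (h.ehi - h.mx < kcRLo (rB + 1)))

/-- the hole admits no missing-row depth in `[93.5, 140)`. -/
def kcHoleInfeasible (rhi : ℕ) (h : KcH) : Bool := decide (h.ehi - h.mx < kcEMIN) || decide (kcETOP ≤ h.elo - rhi)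

/-- C leaf (charge budget) for non-key holes `h` (column `c`) and `h'` (column `c'`). -/
def kcLeafC (c c' E10 rhi : ℕ) (h h' : KcH) (rA rB rA' rB' : ℕ) : Bool :=
  (decide (rA = 0) && kcHoleInfeasible rhi h) || (decide (rA' = 0) && kcHoleInfeasible rhi h') ||
    (kcHoleRange rhi h rA rB && kcHoleRange rhi h' rA' rB' &&
      decide (kcRangeMax c rA (rB + 1 - rA) + kcRangeMax c' rA' (rB' + 1 - rA') ≤ E10))

/-- the largest even `n` with `n ≤ 160/ρlo + 2`. -/
def kcNmax (rlo : ℕ) : ℕ := (160 * kcD / rlo + 2) / 2 * 2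

/-- one candidate of the L test at `a₂·D = x`: `2ρhi²(nmax-2) + (lower bounds of A₁ + A₂ + B₂ + B₃ moved to the sides)`. -/
def kcLeafLAt (t₂ : ℕ) (s : KcS) (x : ℕ) : Bool :=
  let b := max s.h₂.blo (t₂ * s.rlo / 10 - x)
  decide (2 * (s.rhi * s.rhi) * (kcNmax s.rlo - 2) + s.h₁.alo * s.h₁.alo + s.h₃.blo * s.h₃.blo + x * x + b * b <
    2 * s.h₁.alo * s.h₁.elo + 2 * s.h₃.blo * s.h₃.elo + 2 * x * s.h₂.elo + 2 * b * s.h₂.elo)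

/-- L leaf (joint leg budget): three candidates — both ends of `a₂` and the breakpoint `k₂ρlo - blo₂` (clamped). -/
def kcLeafL (t₂ : ℕ) (s : KcS) : Bool :=
  decide (0 < s.rlo) && kcLeafLAt t₂ s s.h₂.alo && kcLeafLAt t₂ s s.h₂.ahi &&
    kcLeafLAt t₂ s (min (max (t₂ * s.rlo / 10 - s.h₂.blo) s.h₂.alo) s.h₂.ahi)

/-- the relaxed parabola test FAILS at step count `n` for both ends `x ∈ {elLo, elHi}` of the source depth:
`x² + n·aL² + ρhi²·n(n-1) < erLo² + 2n·aL·x`. -/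
def kcParFail (R2 aL elLo elHi erLo n : ℕ) : Bool :=
  decide (elLo * elLo + n * (aL * aL) + R2 * (n * (n - 1)) < erLo * erLo + 2 * n * (aL * elLo)) &&
    decide (elHi * elHi + n * (aL * aL) + R2 * (n * (n - 1)) < erLo * erLo + 2 * n * (aL * elHi))

/-- the relaxed leg test FAILS at step count `n`: `2ρhi²(n-1) + aL² + bR² < 2·aL·elLo + 2·bR·erLo`. -/
def kcLegFail (R2 aL elLo bR erLo n : ℕ) : Bool :=
  decide (2 * R2 * (n - 1) + aL * aL + bR * bR < 2 * aL * elLo + 2 * bR * erLo)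

/-- the pieces cover the even step counts in `(pos, stop]`. -/
def kcPieces (R2 aL elLo elHi bR erLo erHi stop : ℕ) : ℕ → List (ℕ × ℕ × Bool) → Bool
  | pos, [] => decide (stop ≤ pos)
  | pos, (u, v, f) :: rest =>
    decide (stop ≤ pos) ||
      (decide (u = pos + 2) && decide (u ≤ v) && decide (v % 2 = 0) &&
        (bif f then kcParFail R2 aL elLo elHi erLo u && kcParFail R2 aL elLo elHi erLo v
          else kcParFail R2 bR erLo erHi elLo u && kcParFail R2 bR erLo erHi elLo v) &&
        kcPieces R2 aL elLo elHi bR erLo erHi stop v rest)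

/-- every even `n ∈ [2, stop]` fails the relaxed leg test (`n ≤ nL`) or a relaxed parabola test (pieces). -/
def kcCovered (R2 aL elLo elHi bR erLo erHi nL : ℕ) (cov : List (ℕ × ℕ × Bool)) (stop : ℕ) : Bool :=
  decide (stop < 2) ||
    (decide (nL % 2 = 0) && (decide (nL < 2) || kcLegFail R2 aL elLo bR erLo nL) &&
      kcPieces R2 aL elLo elHi bR erLo erHi stop nL cov)

/-- W leaf (window): gap 1 needs at least `n₁` steps and gap 2 cannot fit in the remaining `nmax - n₁`. -/
def kcLeafW (s : KcS) (n₁ nL₁ : ℕ) (cov₁ : List (ℕ × ℕ × Bool)) (nL₂ : ℕ) (cov₂ : List (ℕ × ℕ × Bool)) : Bool :=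
  decide (0 < s.rlo) && decide (n₁ % 2 = 0) && decide (2 ≤ n₁) &&
    kcCovered (s.rhi * s.rhi) s.h₁.alo s.h₁.elo s.h₁.ehi s.h₂.blo s.h₂.elo s.h₂.ehi nL₁ cov₁ (n₁ - 2) &&
    kcCovered (s.rhi * s.rhi) s.h₂.alo s.h₂.elo s.h₂.ehi s.h₃.blo s.h₃.elo s.h₃.ehi nL₂ cov₂ (kcNmax s.rlo - n₁)

/-- The checker. -/
def kcCheck (cs : KcCase) : KcT → KcS → Bool
  | .C rA rB rA' rB', s =>
    if cs.p = 1 then kcLeafC cs.c₂ cs.c₃ cs.E10 s.rhi s.h₂ s.h₃ rA rB rA' rB'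
    else kcLeafC cs.c₁ cs.c₃ cs.E10 s.rhi s.h₁ s.h₃ rA rB rA' rB'
  | .L, s => kcLeafL cs.t₂ s
  | .W n₁ nL₁ cov₁ nL₂ cov₂, s => kcLeafW s n₁ nL₁ cov₁ nL₂ cov₂
  | .S ax tl th, s => kcCheck cs tl (kcSplit cs s ax).1 && kcCheck cs th (kcSplit cs s ax).2


/-! ## §S1 Arithmetic helpers (casts of truncated subtraction and division; quadratic endpoint lemmas) -/

/-- `kc_cast_tsub_le` (docstring added by the landing lane; see the module docstring). [formal bookkeeping] -/
theorem kc_cast_tsub_le {x y : ℕ} {z : ℝ} (hz : 0 ≤ z) (h : (x : ℝ) - y ≤ z) : ((x - y : ℕ) : ℝ) ≤ z := by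
  rcases le_total y x with hxy | hxy
  · rw [Nat.cast_sub hxy]; exact h
  · rw [Nat.sub_eq_zero_of_le hxy]; simpa using hz

/-- `kc_le_cast_tsub` (docstring added by the landing lane; see the module docstring). [formal bookkeeping] -/
theorem kc_le_cast_tsub {x y : ℕ} {z : ℝ} (h : z ≤ (x : ℝ) - y) : z ≤ ((x - y : ℕ) : ℝ) := by
  rcases le_total y x with hxy | hxy
  · rw [Nat.cast_sub hxy]; exact h
  · rw [Nat.sub_eq_zero_of_le hxy]
    have : (x : ℝ) ≤ y := by exact_mod_cast hxy
    simp; linarith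

/-- `kc_cast_tsub_of_le` (docstring added by the landing lane; see the module docstring). [formal bookkeeping] -/
theorem kc_cast_tsub_of_le {x y : ℕ} (h : y ≤ x) : ((x - y : ℕ) : ℝ) = (x : ℝ) - y := by
  rw [Nat.cast_sub h]

/-- `kc_cast_div10_le` (docstring added by the landing lane; see the module docstring). [formal bookkeeping] -/
theorem kc_cast_div10_le (x : ℕ) : ((x / 10 : ℕ) : ℝ) ≤ (x : ℝ) / 10 := by
  have h : (x / 10) * 10 ≤ x := Nat.div_mul_le_self x 10
  have h' : ((x / 10 : ℕ) : ℝ) * 10 ≤ x := by exact_mod_cast h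
  linarith

/-- `kc_le_cast_cdiv10` (docstring added by the landing lane; see the module docstring). [formal bookkeeping] -/
theorem kc_le_cast_cdiv10 (x : ℕ) : (x : ℝ) / 10 ≤ (((x + 9) / 10 : ℕ) : ℝ) := by
  have h : x ≤ (x + 9) / 10 * 10 := by omega
  have h' : (x : ℝ) ≤ (((x + 9) / 10 : ℕ) : ℝ) * 10 := by exact_mod_cast h
  linarith

/-- `kc_cast_half_le` (docstring added by the landing lane; see the module docstring). [formal bookkeeping] -/
theorem kc_cast_half_le (x y : ℕ) : ((((x + y) / 2 : ℕ)) : ℝ) ≤ ((x + y : ℕ) : ℝ) := by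
  exact_mod_cast Nat.div_le_self (x + y) 2

/-- `y ↦ y(2e − y)` is monotone below `e`, and monotone in `e`. -/
theorem kc_mono_sq {lo x ylo y : ℝ} (h0 : 0 ≤ lo) (h1 : lo ≤ x) (h2 : x ≤ y) (h3 : ylo ≤ y) :
    lo * (2 * ylo - lo) ≤ x * (2 * y - x) := by nlinarith

/-- a concave quadratic on an interval is at least its smaller endpoint value. -/
theorem kc_concave_min {p q r lo hi x : ℝ} (hp : p ≤ 0) (hlo : lo ≤ x) (hhi : x ≤ hi) :
    min (p * lo * lo + q * lo + r) (p * hi * hi + q * hi + r) ≤ p * x * x + q * x + r := by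
  by_cases h : 0 ≤ p * (x + lo) + q
  · have : p * lo * lo + q * lo + r ≤ p * x * x + q * x + r := by nlinarith
    exact le_trans (min_le_left _ _) this
  · rw [not_le] at h
    have h' : p * (x + hi) + q ≤ p * (x + lo) + q := by nlinarith
    have : p * hi * hi + q * hi + r ≤ p * x * x + q * x + r := by nlinarith
    exact le_trans (min_le_right _ _) this

/-- a convex quadratic on an interval is at most its larger endpoint value. -/
theorem kc_convex_max {p q r lo hi x : ℝ} (hp : 0 ≤ p) (hlo : lo ≤ x) (hhi : x ≤ hi) :
    p * x * x + q * x + r ≤ max (p * lo * lo + q * lo + r) (p * hi * hi + q * hi + r) := by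
  by_cases h : p * (x + lo) + q ≤ 0
  · have : p * x * x + q * x + r ≤ p * lo * lo + q * lo + r := by nlinarith
    exact le_trans this (le_max_left _ _)
  · rw [not_le] at h
    have h' : p * (x + lo) + q ≤ p * (x + hi) + q := by nlinarith
    have : p * x * x + q * x + r ≤ p * hi * hi + q * hi + r := by nlinarith
    exact le_trans this (le_max_right _ _)

/-- `kcD_pos` (docstring added by the landing lane; see the module docstring). [formal bookkeeping] -/
theorem kcD_pos : (0 : ℝ) < kcD := by norm_num [kcD]
/-- `kcEMIN_eq` (docstring added by the landing lane; see the module docstring). [formal bookkeeping] -/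
theorem kcEMIN_eq : (kcEMIN : ℝ) = 187 / 2 * kcD := by norm_num [kcEMIN, kcD]
/-- `kcETOP_eq` (docstring added by the landing lane; see the module docstring). [formal bookkeeping] -/
theorem kcETOP_eq : (kcETOP : ℝ) = 140 * kcD := by norm_num [kcETOP, kcD]

/-! ## §S2 The window count, the row cells, the table -/

/-- an even total step count within the window is at most `kcNmax ρlo`. -/
theorem kc_le_nmax {rlo : ℕ} (hr : 0 < rlo) {ρ : ℝ} (hρ : (rlo : ℝ) ≤ ρ * kcD) {N : ℕ} (hN : Even N)
    (hw : ρ * (N : ℝ) ≤ 160 + 2 * ρ) : N ≤ kcNmax rlo := by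
  have hD := kcD_pos
  have hrpos : (0 : ℝ) < rlo := by exact_mod_cast hr
  have hρ0 : 0 < ρ := by nlinarith
  unfold kcNmax
  set q := 160 * kcD / rlo with hq
  -- (N - 2) * rlo ≤ 160 * kcD
  have h1 : (N - 2) * rlo ≤ 160 * kcD := by
    rcases le_or_gt N 2 with hN2 | hN2
    · rw [Nat.sub_eq_zero_of_le hN2]; simp
    have hc : (((N - 2 : ℕ) : ℝ)) = (N : ℝ) - 2 := by rw [Nat.cast_sub hN2.le]; norm_num
    have hreal : ((N : ℝ) - 2) * rlo ≤ 160 * kcD := by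
      have : ((N : ℝ) - 2) * ρ ≤ 160 := by nlinarith
      calc ((N : ℝ) - 2) * rlo ≤ ((N : ℝ) - 2) * (ρ * kcD) := by
            apply mul_le_mul_of_nonneg_left hρ; have : (2 : ℝ) < N := by exact_mod_cast hN2
            linarith
        _ = (((N : ℝ) - 2) * ρ) * kcD := by ring
        _ ≤ 160 * kcD := by nlinarith
    have : (((N - 2) * rlo : ℕ) : ℝ) ≤ ((160 * kcD : ℕ) : ℝ) := by push_cast; rw [hc]; exact hreal
    exact_mod_cast this
  have h2 : N - 2 ≤ q := by rw [hq]; exact (Nat.le_div_iff_mul_le hr).2 h1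
  obtain ⟨k, hk⟩ := hN
  omega

/-- `kc_RLo_mono` (docstring added by the landing lane; see the module docstring). [formal bookkeeping] -/
theorem kc_RLo_mono {r r' : ℕ} (h : r ≤ r') : kcRLo r ≤ kcRLo r' := by
  unfold kcRLo; split_ifs <;> omega

/-- `kc_RHi_mono` (docstring added by the landing lane; see the module docstring). [formal bookkeeping] -/
theorem kc_RHi_mono {r r' : ℕ} (h : r ≤ r') : kcRHi r ≤ kcRHi r' := by
  unfold kcRHi kcETOP; split_ifs <;> omega

/-- the row of an admissible missing-row depth and its scaled cell. -/
theorem kc_row_cell {m : ℝ} (h1 : 187 / 2 ≤ m) (h2 : m < 140) :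
    1 ≤ capKRow m ∧ capKRow m ≤ 74 ∧ (kcRLo (capKRow m) : ℝ) ≤ m * kcD ∧ m * kcD < kcRHi (capKRow m) := by
  have hD := kcD_pos
  unfold capKRow
  rw [if_neg (not_lt.2 h1)]
  by_cases h130 : m < 130
  · rw [if_pos h130]
    set F := ⌊(m - 187 / 2) * 2⌋₊ with hF
    have hF0 : (0 : ℝ) ≤ (m - 187 / 2) * 2 := by linarith
    have hFle : (F : ℝ) ≤ (m - 187 / 2) * 2 := Nat.floor_le hF0
    have hFlt : (m - 187 / 2) * 2 < F + 1 := Nat.lt_floor_add_one _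
    have hF72 : F ≤ 72 := by
      have : F < 73 := (Nat.floor_lt hF0).2 (by linarith)
      omega
    refine ⟨by omega, by omega, ?_, ?_⟩
    · unfold kcRLo; rw [if_pos (by omega)]
      have : (((935000 + 5000 * (1 + F - 1)) * 2 ^ 44 : ℕ) : ℝ) = (187 / 2 + (F : ℝ) / 2) * kcD := by
        rw [show 1 + F - 1 = F by omega]; push_cast; norm_num [kcD]; ring
      rw [this]; nlinarith
    · unfold kcRHi; rw [if_pos (by omega)]
      have : (((935000 + 5000 * (1 + F)) * 2 ^ 44 : ℕ) : ℝ) = (187 / 2 + ((F : ℝ) + 1) / 2) * kcD := by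
        push_cast; norm_num [kcD]; ring
      rw [this]; nlinarith
  · rw [if_neg h130]
    rw [not_lt] at h130
    refine ⟨by omega, le_rfl, ?_, ?_⟩
    · unfold kcRLo; rw [if_neg (by omega)]
      have : (((1300000 * 2 ^ 44 : ℕ)) : ℝ) = 130 * kcD := by norm_num [kcD]
      rw [this]; nlinarith
    · unfold kcRHi; rw [if_neg (by omega), kcETOP_eq]; nlinarith

/-- the table read by the checker is ten times the (non-negative) tree table. -/
def kcTabOK : Bool :=
  (List.range 75).all fun r => (List.range 13).all fun c =>
    decide (((kcTab10 r c : ℕ) : ℚ) = max 0 ((capKRows.getD r []).getD c 0) * 10)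

/-- `kcTabOK_true` (docstring added by the landing lane; see the module docstring). [formal bookkeeping] -/
theorem kcTabOK_true : kcTabOK = true := by
  decide +kernel

/-- `kc_tab10` (docstring added by the landing lane; see the module docstring). [formal bookkeeping] -/
theorem kc_tab10 {r c : ℕ} (hr : r ≤ 74) (hc : c ≤ 12) :
    ((kcTab10 r c : ℕ) : ℝ) = max 0 (((capKRows.getD r []).getD c 0 : ℚ) : ℝ) * 10 := by
  have h := kcTabOK_true
  unfold kcTabOK at h
  rw [List.all_eq_true] at h
  have h1 := h r (List.mem_range.2 (by omega))
  rw [List.all_eq_true] at h1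
  have h2 : ((kcTab10 r c : ℕ) : ℚ) = max 0 ((capKRows.getD r []).getD c 0) * 10 :=
    of_decide_eq_true (h1 c (List.mem_range.2 (by omega)))
  have h3 : (((kcTab10 r c : ℕ) : ℚ) : ℝ) = ((max 0 ((capKRows.getD r []).getD c 0) * 10 : ℚ) : ℝ) := by rw [h2]
  push_cast at h3
  exact h3

/-- `kc_rangeMax_ge` (docstring added by the landing lane; see the module docstring). [formal bookkeeping] -/
theorem kc_rangeMax_ge (c rA : ℕ) : ∀ (len r : ℕ), rA ≤ r → r < rA + len → kcTab10 r c ≤ kcRangeMax c rA len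
  | 0, r, h1, h2 => by omega
  | len + 1, r, h1, h2 => by
    unfold kcRangeMax
    rcases Nat.lt_or_ge r (rA + len) with h | h
    · exact le_trans (kc_rangeMax_ge c rA len r h1 h) (le_max_right _ _)
    · have : r = rA + len := by omega
      subst this; exact le_max_left _ _

end Summit.AtomisticToContinuum.Crystallization.Theorems.ChargedEnergyGapChartDial
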